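import Mathlib
import HarnessLib
import HarnessLib.Audit
import Summits.AtomisticToContinuum.Statement
import Literature.MathematicalPhysics.StatisticalMechanics.LennardJonesClusters
import Literature.MathematicalPhysics.StatisticalMechanics.BarlowStacking
import Summits.AtomisticToContinuum.Crystallization.Theorems.ThreeConeCertificateTrialStateUpper
import Summits.AtomisticToContinuum.Crystallization.Theorems.ThreeConeCertificateEnergeticHalf
import HarnessLib.Audit.Status.Attr

/-!
Route: BraggSlacknessRigidity

DORMANT since 2026-08-24T06:33:32Z (reconciler: no traction for 6.6 d (last activity item-evidence-added at 2026-08-17T16:13:18Z); parked, not closed — `ledger route dormant route-AtomisticToContinuum-BraggSlacknessRigidity --off` to re) — unstaffed, not closed; items shared with open routes are served there. `ledger route dormant <id> --off` reactivates.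

# Route BraggSlacknessRigidity — exact certificate read on both sides — hcp distances plus Bragg
spheres force periodic windows, no kissing geometry

X = StrictCertificate ∧ HcpDiffractionRigidity ("it suffices to show"). StrictCertificate (FUEL, the
shared bet of every
certificate route): Lennard-Jones admits an EXACT zero-pressure split V_LJ = g + U + f on (0,∞) at
an hcp template
P = hcpPeriodicConfiguration a h (g of finite range ρ and c-stable, U ≥ 0, f radial of positive
type, c + f(0)/2 = −e(P)) that is
STRICT: U is continuous and vanishes only on the distance set D_P, and F = f∘‖·‖ is continuous,
integrable, with integrable real
Fourier transform f̂ ≥ 0 vanishing off 0 only on spheres through the dual lattice of P.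
HcpDiffractionRigidity (ENGINE, potential-free,
the card's "spherical Lev–Olevskii problem" posed RELATIVE TO AN hcp TEMPLATE, finite-N form): a
hard-core sequence of N-point
configurations whose pair distances at every fixed range lie in D_P up to o(N) pairs (S2) and whose
structure factor carries o(N) mass on
compact sets off {0} ∪ {Bragg spheres of P} (S3) converges locally, along a subsequence and after
translations, to a non-zero periodic
point measure. Conforming re-filing (D-0027 §2.1) of retired route SphericalLevOlevskii for card
diffraction-rigidity-spherical-lev-olevskii:
same mechanism, rigidity cruxes sharpened to hcp templates (where a distance determines the layer
count), deciding theorem `closes` supplied.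
Lean: `(∃ (P : Literature.MathematicalPhysics.StatisticalMechanics.PeriodicConfiguration 3) (ρ c :
ℝ) (g U f : ℝ → ℝ), (∃ (a h : ℝ) (ha : a ≠ 0) (hh : h ≠ 0), P =
Literature.MathematicalPhysics.StatisticalMechanics.hcpPeriodicConfiguration ha hh) ∧ (∀ r : ℝ, 0 <
r → Literature.MathematicalPhysics.StatisticalMechanics.lennardJones r = g r + U r + f r) ∧ (∀ r :
ℝ, 0 < r → 0 ≤ U r) ∧ (∀ r : ℝ, ρ ≤ r → g r = 0) ∧ (∀ (n : ℕ) (y : Fin n → EuclideanSpace ℝ (Fin 3))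
(w : Fin n → ℝ), 0 ≤ ∑ i, ∑ j, w i * w j * f (dist (y i) (y j))) ∧ (∀ (N : ℕ) (x : Fin N →
EuclideanSpace ℝ (Fin 3)), Function.Injective x → -(c * (N : ℝ)) ≤
Literature.MathematicalPhysics.StatisticalMechanics.interactionEnergy g x) ∧ c + f 0 / 2 =
-(P.energyPerParticle Literature.MathematicalPhysics.StatisticalMechanics.lennardJones) ∧
ContinuousOn U (Set.Ioi 0) ∧ (∀ r : ℝ, 0 < r → U r = 0 → ∃ a ∈ P.points, ∃ b ∈ P.points, r = dist a
b) ∧ Continuous (fun v : EuclideanSpace ℝ (Fin 3) => (f ‖v‖ : ℂ)) ∧ MeasureTheory.Integrable (fun v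
: EuclideanSpace ℝ (Fin 3) => (f ‖v‖ : ℂ)) ∧ MeasureTheory.Integrable (FourierTransform.fourier (fun
v : EuclideanSpace ℝ (Fin 3) => (f ‖v‖ : ℂ))) ∧ (∀ ξ : EuclideanSpace ℝ (Fin 3),
(FourierTransform.fourier (fun v : EuclideanSpace ℝ (Fin 3) => (f ‖v‖ : ℂ)) ξ).im = 0 ∧ 0 ≤
(FourierTransform.fourier (fun v : EuclideanSpace ℝ (Fin 3) => (f ‖v‖ : ℂ)) ξ).re) ∧ (∀ ξ :
EuclideanSpace ℝ (Fin 3), ξ ≠ 0 → (∀ k : EuclideanSpace ℝ (Fin 3), (∀ g ∈ P.lattice, ∃ n : ℤ, inner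
ℝ k g = (n : ℝ)) → ‖ξ‖ ≠ ‖k‖) → FourierTransform.fourier (fun v : EuclideanSpace ℝ (Fin 3) => (f ‖v‖
: ℂ)) ξ ≠ 0)) ∧ (∀ (P : Literature.MathematicalPhysics.StatisticalMechanics.PeriodicConfiguration
3), (∃ (a h : ℝ) (ha : a ≠ 0) (hh : h ≠ 0), P =
Literature.MathematicalPhysics.StatisticalMechanics.hcpPeriodicConfiguration ha hh) → ∀ δ : ℝ, 0 < δ
→ ∀ x : (N : ℕ) → (Fin N → EuclideanSpace ℝ (Fin 3)), (∀ (N : ℕ) (i j : Fin N), i ≠ j → δ ≤ dist (x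
N i) (x N j)) → (∀ R η : ℝ, 0 < η → Filter.Tendsto (fun N : ℕ => (Nat.card {p : Fin N × Fin N // p.1
≠ p.2 ∧ dist (x N p.1) (x N p.2) ≤ R ∧ ∀ a ∈ P.points, ∀ b ∈ P.points, η ≤ |dist (x N p.1) (x N p.2)
- dist a b|} : ℝ) / N) Filter.atTop (nhds 0)) → (∀ h : EuclideanSpace ℝ (Fin 3) → ℝ, Continuous h →
HasCompactSupport h → (∀ ξ ∈ tsupport h, ξ ≠ 0 ∧ ∀ k : EuclideanSpace ℝ (Fin 3), (∀ g ∈ P.lattice, ∃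
n : ℤ, inner ℝ k g = (n : ℝ)) → ‖ξ‖ ≠ ‖k‖) → Filter.Tendsto (fun N : ℕ => (∫ ξ, h ξ * ‖∑ j : Fin N,
Complex.exp (2 * Real.pi * Complex.I * (inner ℝ ξ (x N j) : ℂ))‖ ^ 2) / N) Filter.atTop (nhds 0)) →
∃ (φ : ℕ → ℕ) (τ : ℕ → EuclideanSpace ℝ (Fin 3)) (Q :
Literature.MathematicalPhysics.StatisticalMechanics.PeriodicConfiguration 3) (m : EuclideanSpace ℝ
(Fin 3) → ℕ), StrictMono φ ∧ (∀ s ∈ Q.points, 1 ≤ m s) ∧ (∀ g ∈ Q.lattice, ∀ s, m (s + g) = m s) ∧ ∀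
f : EuclideanSpace ℝ (Fin 3) → ℝ, Continuous f → HasCompactSupport f → Filter.Tendsto (fun j => ∑ i
: Fin (φ j), f (x (φ j) i + τ j)) Filter.atTop (nhds (∑' s : Q.points, (m s : ℝ) * f s)))`

## Assembly
DECIDING THEOREM (D-0027 §2.1): glue.lean `theorem closes (StrictCertificate)
(HcpDiffractionRigidity) (StrictImpliesExact) (CertificateBound)
(EnergeticHalf) (TrialStateUpper) (SlacknessTransfer) : Crystallization` — seven load-bearing items,
conclusion the sub-problem decl
`_root_.Crystallization` by name, PROVED sorry-free in Sketch.lean (two lines of logic plus the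
proved Literature theorem
LennardJonesMinimalDistance_holds): StrictImpliesExact turns StrictCertificate into
ExactCertificate, CertificateBound into KeplerBound,
EnergeticHalf with TrialStateUpper into HasPeriodicGroundStateEnergy lennardJones 3;
SlacknessTransfer fed with StrictCertificate,
TrialStateUpper, LennardJonesMinimalDistance_holds and HcpDiffractionRigidity gives IsCrystallizing
lennardJones 3; the pair is
Crystallization. CommensurateHcpRigidity and CommensurateOfHcp are not antecedents: the former is
the strict special case whose proof
de-risks the rank-2 crux and whose refutation kills the line. The Assembly item is the same
implication as a Prop (Assembly_provable).

Rationale: WHY THIS LINE. An exact certificate proves conjunct (i) and, read through complementary slackness on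
BOTH sides (CohnKumar2006 §9, CohnEtAl2019,
TorquatoStillinger2008; the f = φ case is Suto2006's "S(k) = 0 on supp φ̂ ⟺ ground state"), pins the
pair distances of every ground-state
sequence to D_P (slack U) and its structure factor to the Bragg spheres of P (slack f̂, via Σ_{i,j}
F(x_i − x_j) = ∫ f̂ |Σ_j e^{2πi ξ·x_j}|²);
conjunct (ii) then becomes a harmonic-analysis rigidity statement in the spirit of Lev–Olevskii
(LevOlevskii2014 Thm 2, LevOlevskii2017
Thm 2.5: uniformly discrete support + spectrum ⇒ Dirac combs) instead of 12-neighbour geometry.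
Imported areas: Fourier quasicrystals /
mathematical diffraction (BaakeFrettlohGrimm2007, Meyer2016, KurasovSarnak2020, AlonEtAl2024) and
the arithmetic of distance sets
(Gram integrality; AnningErdos1945: an infinite set with integral mutual distances is collinear).
New relative to the retired filing and its
refuter audits (radialisation loses uniform discreteness; AKKV non-comb quasicrystals): the template
is hcp(a, h), whose squared distances are
a²(ℓ + t m²), t = h²/a², ℓ Löschian (m even) or Löschian + 1/3 (m odd); for t ∉ ℚ a distance
DETERMINES the layer count |m|, the t-part of
the Gram pencil is a rational quadratic form taking only square values on the difference set, hence
positive and — by Anning–Erdős — of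
rank one: local limits are LAYERED with spacing h and lattice-confined, and uniform discreteness of
the spectrum is then forced by
periodicity along M* ("rods are not spheres"); for t ∈ ℚ Gram integrality confines local limits to
one lattice directly (rank-4 crux).
No open route uses distance arithmetic or spectral discreteness; the negatives index (6 refuted
statements, none on distances/diffraction;
OneGrainGluing died of a missing hard core, which both rigidity cruxes carry) is steered around.

RANKED CRUXES. #2 HcpDiffractionRigidity (crux) — hcp-TEMPLATE DIFFRACTION RIGIDITY (card item F3,
finite-N form). For every hcp template P = hcpPeriodicConfiguration a h (a, h ≠ 0; layers of the
triangular lattice of spacing a at heights kh, lattice A₂(a) × 2hℤ), every δ > 0 and every sequence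
x^N of N-point configurations with pairwise distances ≥ δ: if (S2) for every range R and tolerance η
> 0 the number of ordered pairs i ≠ j with |x_i − x_j| ≤ R whose distance is η-far from D_P = {|p −
q| : p, q ∈ P} is o(N), and (S3) for every continuous compactly supported h on frequency space whose
support avoids 0 and every sphere {‖ξ‖ = ‖k‖}, k in the dual lattice of P.lattice, (1/N)∫ h(ξ)|Σ_j
e^{2πi⟨ξ,x_j⟩}|² dξ → 0, THEN there are a subsequence N_j, translations τ_j, a periodic
configuration Q and Q.lattice-periodic multiplicities m ≥ 1 on Q with Σ_i f(x_i^{N_j} + τ_j) → Σ_{s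
∈ Q} m(s) f(s) for every continuous compactly supported f (exactly the conclusion of
IsCrystallizing; existential Q absorbs homometric partners, polycrystals with growing grains,
density-zero faults and any relaxed c/a). [difficulty: XL] (why it might fail: Uniform discreteness
of the SPECTRUM must come from radial data (refuter-12, AlonEtAl2024): for t = h²/a² quadratic (or
algebraic of degree ≤ 4) the Gram-pencil/rod arguments leave dense admissible Bragg heights, and the
windowed transfer of S3 to local limits is unproved.) [LevOlevskii2014, LevOlevskii2017,
AnningErdos1945, BaakeFrettlohGrimm2007, AlonEtAl2024, KurasovSarnak2020, Meyer2016, GrimmBaake2008]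
#3 StrictCertificate (crux) — STRICT EXACT CERTIFICATE FOR LENNARD-JONES AT AN hcp TEMPLATE (card
item F4 + the card's design requirement). There are P = hcpPeriodicConfiguration a h, ρ, c and g, U,
f : ℝ → ℝ with V_LJ = g + U + f on (0,∞), U ≥ 0 on (0,∞), g ≡ 0 on [ρ,∞), f of positive type on ℝ³
as a radial function (finite quadratic forms), g c-stable on all finite configurations of distinct
points, c + f(0)/2 = −e(P) [these clauses are CrystalThreeCone's ExactCertificate with P specialised
to hcp], AND: U continuous on (0,∞) with U(r) = 0 ⇒ r ∈ D_P; F(v) = f(‖v‖) continuous and integrable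
on ℝ³ with integrable Fourier transform 𝓕F, 𝓕F real and ≥ 0 everywhere, and 𝓕F(ξ) ≠ 0 whenever ξ ≠ 0
and ‖ξ‖ is not the norm of a dual-lattice vector of P.lattice (f̂ may vanish on extinct Bragg
spheres). Expected: relaxed hcp, a ≈ 0.9712, h/a ≈ √(2/3). [difficulty: open-problem] (why it might
fail: Shares every certificate route's open bet (Li2022 gap on the two-point ray; CrystalThreeCone
NoGap numerics) and adds strictness: exactness may force U to vanish off D_P or f̂ on a non-Bragg
sphere, and f̂ ≥ 0 with f̂(0) = 0 must beat the −r⁻⁶ tail; hcp must be THE periodic minimiser.)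
[CohnKumar2006, CohnEtAl2019, Li2022, Ruelle1969, TorquatoStillinger2008, Suto2006, Stillinger2001]
#4 CommensurateHcpRigidity (crux) — THE COMMENSURATE CASE (the card's "ideal test", first theorem):
HcpDiffractionRigidity restricted to hcp templates with h² = q a², q ∈ ℚ (ideal hcp: q = 2/3), so
that D_P² ⊂ (a²/(3·den q))ℕ. Proof plan: (A) around all but o(N) particles every pair in the
R_N-ball is η_N-close to D_P (η_N → 0, R_N → ∞), so in any local limit Λ∞ ALL squared distances lie
in αℕ; Gram/frame integrality ⟨z − p₀, f_i⟩ ∈ (α/2)ℤ puts Λ∞ inside p₀ + (α/2)F* — ONE lattice M;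
(B) the autocorrelation γ of Λ∞ lives on M, so γ̂ is M*-periodic; M*-periodic + carried by {0} ∪
spheres with radii² in a set commensurate with M ⇒ supp γ̂ lies in a lattice N ⊇ M* ⇒ γ̂ = Σ_s a_s
δ_{s+M*} over finitely many classes ⇒ the autocorrelation coefficients are a finite non-negative
trigonometric polynomial attaining its maximum (the density) exactly on a finite-index sublattice L′
⇒ Λ∞ is L′-periodic off a density-zero set ⇒ arbitrarily large exact periodic windows ⇒ the
conclusion (hard core + matching, CrystallizationLocalLimit in tree); (C) S3 passes to local limits
around most centres by the Plancherel identity ∫_t |𝓕(ψ_t μ_N)|² = |ψ̂|² ∗ |μ̂_N|², the bound ∫_K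
|μ̂_N|² ≤ C_δ,K N for δ-separated points, and lower semicontinuity of intensities on open sets.
[difficulty: L] (why it might fail: Sheet-like or sparse local limits (rods, diffuse background)
must be excluded by S3 alone; the windowed transfer of S3 (Plancherel + l.s.c.) is unproved in this
finite-N form; an hcp twin network of bounded spacing with all cross distances in D_P would stress
step (A).) [LevOlevskii2014, GrimmBaake2008, BaakeGrimm2013, HalesDSP2012, BlancLewin2015]
#9 ExactCertificate (support) — shared with retired CrystalThreeCone / SphericalLevOlevskii (stmt
3100, identical signature; general periodic template): an exact three-cone certificate exists — P
periodic, ρ, c, g, U, f with V_LJ = g + U + f on (0,∞), U ≥ 0, g ≡ 0 on [ρ,∞), f of positive type, g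
c-stable, c + f(0)/2 = −e(P). Here the projection of StrictCertificate; kept general so the
energetic half is template-free. [difficulty: open-problem] [CohnKumar2006, Ruelle1969, Li2022]
#9 KeplerBound (support) — shared (stmt 3102): some periodic P has N·e(P) ≤ E_N(x) for every N and
every configuration of N distinct points (the optimal LJ stability constant is a periodic energy per
particle, expected 0.7176 in tree units). [difficulty: open-problem] [BlancLewin2015, Ruelle1969]
#9 CertificateBound (support) — shared glue (stmt 3103): an exact certificate gives the Kepler bound
— U-cone ≥ 0 termwise, the Bochner form with w ≡ 1 gives 2Σ_{i<j} f ≥ −N f(0)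
(two_mul_interactionEnergy_eq_sum_sum in tree), g-stability gives Σ_{i<j} g ≥ −cN; add and use c +
f(0)/2 = −e(P). [difficulty: provable-now] [Ruelle1969]
#9 TrialStateUpper (support) — shared (stmt 3104): for every periodic Q and ε > 0, eventually E(N)/N
≤ e(Q) + ε (finite blocks of Q as N-point trial states; O(N^{2/3}) boundary particles lose O(1) each
by the summable r⁻⁶ tail). Implies limsup E(N)/N ≤ ⨅ e by le_ciInf. [difficulty: M] [BlancLewin2015]
#9 EnergeticHalf (support) — shared glue (stmt 3105): KeplerBound + TrialStateUpper ⇒ conjunct (i)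
HasPeriodicGroundStateEnergy lennardJones 3 (e(P) ≤ E(N)/N by le_ciInf over the non-empty injective
configurations, nonempty_injective_config in tree; TrialStateUpper at Q = P gives the limit, at
general Q gives IsLeast). [difficulty: provable-now] [BlancLewin2015]
#9 StrictImpliesExact (support) — glue (projection; sorry-free in Sketch.lean): a strict hcp
certificate is in particular an exact one — forget the template description and the last six
conjuncts. [difficulty: provable-now] [Ruelle1969]
#9 SlacknessTransfer (support) — TWO-SIDED COMPLEMENTARY SLACKNESS (card items F1/F2/F5, finite-N):
StrictCertificate → TrialStateUpper → LennardJonesMinimalDistance → HcpDiffractionRigidity →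
IsCrystallizing lennardJones 3. Proof: for ground states x^N, E(N) − N e(P) = [E_g + cN] + [Σ_{i<j}
U(r_ij)] + ½[Σ_{i,j} F(x_i − x_j)], three non-negative brackets, and TrialStateUpper at Q = P makes
the left side ≤ εN eventually, so each bracket is o(N); hard core δ from LennardJonesMinimalDistance
(δ = 1/3 in tree); U continuous and > 0 on the compact set {r ∈ [δ,R] : dist(r, D_P) ≥ η} gives
(S2); Fourier inversion for continuous integrable F with integrable 𝓕F (Mathlib
Continuous.fourier_inversion / Integrable.fourierInv_fourier_eq) gives Σ_{i,j} F(x_i − x_j) = ∫ 𝓕F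
|Σ_j e^{2πi⟨ξ,x_j⟩}|², and 𝓕F ≥ 0, continuous, > 0 on tsupport h bounds the S3 functional by the
third bracket; HcpDiffractionRigidity applied to the certificate's template returns exactly the
conclusion of IsCrystallizing. [difficulty: M] [CohnKumar2006, TorquatoStillinger2008, Suto2006,
BlancLewin2015]
#9 CommensurateOfHcp (support) — glue (sorry-free in Sketch.lean): the commensurate case is a
special case of HcpDiffractionRigidity; keeps the rank-4 crux honest as a strict weakening and makes
its refutation fatal for the line. [difficulty: provable-now] [LevOlevskii2014]

TWO-LAYER PLAN. Foreseen glued splits (k ≤ 3, depth 1; nothing filed now). HcpDiffractionRigidity ⇐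
LayeredConfinement (hard core + S2 ⇒ around all but
o(N) particles the local limit Λ∞ has all distances in D_P; t ∉ ℚ: layer count from distances,
square-valued vertical form ⇒ PSD, rank 1 by
Anning–Erdős once dim_ℚ span(Λ∞ − Λ∞) = 3 (Gram-pencil rank ≤ 3 for every 4-tuple; immediate unless
t is algebraic of degree ≤ 4) ⇒
Λ∞ ⊂ p₀ + M with M = (planar lattice commensurate with A₂(a)) ⊕ (h/q)ℤ e₃; t ∈ ℚ: Gram integrality)
→ SpectralPeriodicity (lattice-confined +
S3 ⇒ supp γ̂ ⊂ {0} ∪ L*-spheres and M*-periodic ⇒ split into a⁻²- and h⁻²-components ⇒ supp γ̂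
uniformly discrete ⇒ finite frequency set ⇒
essentially periodic ⇒ clean windows ⇒ conclusion) → HcpDiffractionRigidity. CommensurateHcpRigidity
⇐ WindowedTransfer (S2, S3 localise to
most centres) → CoherentCase (steps (A)+(B)) → CommensurateHcpRigidity. StrictCertificate ⇐
ExactCertificate (a three-cone producer:
LocalConstant → TailInterpolant) → Strictification (perturb U and f inside their cones keeping
exactness at an unwanted zero r* ∉ D_P, using
that P has no pairs at r*) → StrictCertificate.

KILL CRITERIA. CommensurateHcpRigidity refuted (an aperiodic, non-polycrystalline δ-separated
sequence with local squared distances in a²{ℓ + (2/3)m²} — ideal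
hcp — and sphere-supported structure factor but no crystalline local limit) closes the route
`refuted:CommensurateHcpRigidity` (CommensurateOfHcp
makes it ¬HcpDiffractionRigidity). HcpDiffractionRigidity refuted only at a quadratic-irrational t ⇒
pivot (tenure): add the local-tightness
slack (S1: almost every ρ-environment is g-minimising) as a hypothesis, or restate over t outside
the refuted class. StrictCertificate dies with
the certificate programmes' gap results (CrystalThreeCone-type NoGap: certified duality gap ≥ 1 % at
ρ = 9/5 persisting at ρ = 2, 5/2) unless a
hybrid certificate with a strict positive-type component survives (re-fuel); a structural theorem
that every exact LJ certificate has f̂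
vanishing on a non-Bragg sphere or U vanishing off D_P kills the strict form ⇒ close; a certified
periodic Q with e(Q) < e(hcp a h) for all a, h
kills the hcp template ⇒ restate at Q if Q is Barlow, else close. HasPeriodicGroundStateEnergy
refuted elsewhere kills the conjunct and every route.

NOT DECOMPOSED YET. The windowed-S3 transfer lemma (Plancherel identity, ∫_K|μ̂_N|² ≤ C N for
separated points, l.s.c. of intensities under local limits); the
finite-frequency {0,1}-sequence lemma (a {0,1}-pattern on a lattice whose autocorrelation is a
finite non-negative trigonometric polynomial is
periodic off density zero); exclusion of sheet-like/sparse local limits from S3; the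
quadratic-irrational t case; the Anning–Erdős step in
Lean (planar and spatial integral point sets are collinear — short elementary proofs exist); the
design of f̂ near 0 (f̂(ξ) = a₂|ξ|² + O(|ξ|³),
a₂ > 0) and the value of the relaxed h/a — all layer-2, after CommensurateHcpRigidity or a
NoGap-type result moves. No point-process /
autocorrelation-measure definitions are requested: everything is stated through finite structure
factors.

CHEAPEST FALSIFIER. (1) Lookup (done, gen-1 + this session): the pinwheel / quaquaversal tilings are
not counterexamples to the template-relative form —
BaakeFrettlohGrimm2007 §4.3 Claims 2–3: pinwheel distances √((p²+q²)/5^ℓ) with unbounded ℓ, each of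
positive frequency, so (S2) fails at
positive pair density against every hcp template. (2) Kit job for a refuter (finite, cheap):
enumerate coincidence rotations Σ ≤ 49 of
A₂ × cℤ ∪ (w + A₂) × c(ℤ + ½) (ideal hcp, c = 2h) and test whether ANY twist/tilt grain boundary or
antiphase shift has all cross-boundary pair
distances ≤ 3a inside D_hcp = a·√{ℓ + (2/3)m²}; if one exists, stack it aperiodically (Fibonacci
spacing) and compute the 1-D spectral measure
along the normal — step (B) predicts Bragg heights dense on rods (S3 violated); a sphere-supported
outcome refutes CommensurateHcpRigidity.
(3) Arithmetic sanity (done by hand): 8a² (the fcc-only distance two layers apart) ∉ a²{ℓ + (2/3)m²}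
(8 − 8/3 = 16/3 ∉ Löschian, 8 − 2/3·1 = 22/3,
22 ≡ 1 mod 3 but 22 = 2·11 is not Löschian, 8 − 6 = 2 ∉ Löschian + 1/3), so c-letters at positive
density violate S2 against ideal hcp.

NUMBERS. hcpPeriodicConfiguration a h (tree, BarlowStacking.lean): in-layer nearest distance |a|,
adjacent-layer nearest distance √(a²/3 + h²)
(dist_barlowPos_succ_eq), ideal h = a√(2/3); lattice of periods A₂(a) × 2hℤ, dual A₂(a)* × (2h)⁻¹ℤ,
Bragg radii² = (4/(3a²))ℓ + m²/(4h²).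
Squared distances D_P²/a² = {ℓ + t m² : m even, ℓ ∈ {i²+ij+j²} = 0,1,3,4,7,9,12,13,…; m odd, ℓ ∈
{i²+ij+j²+i+j} + 1/3 = 1/3, 4/3, 7/3, 13/3, 16/3,
19/3, 25/3, …}, t = h²/a² (ideal 2/3: 1, 2, 8/3, 3, 11/3, 4, 5, 17/3, 6, 19/3, 20/3, 7, …). fcc adds
8, 20 (not hcp distances²; first separator
√8·a ≈ 2.83a > √(8/3)a, beyond ShortRangeStackingBlindness). Energetics (tree units V = r⁻¹²/12 −
r⁻⁶/6, Stillinger2001): e(hcp) = −0.71759,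
e(fcc) = −0.71752 (Δ ≈ 7e-5); a* ≈ 0.9712; LJ ground-state hard core δ = 1/3
(LennardJonesMinimalDistance_holds). Relaxed LJ-hcp has
h/a ≠ √(2/3) generically (size uncertified; its arithmetic nature unknowable) — the reason
HcpDiffractionRigidity is stated for ALL (a, h)
and the commensurate case separately. Items at open: 12 (3 cruxes, 8 support, 1 assembly); deciding
theorem over 7 of them.

DEFINITION REQUESTS. None. Dual lattice, Bragg spheres, distance set and structure factor are
inlined (∀ g ∈ P.lattice, ∃ n : ℤ, ⟪k,g⟫ = n; ‖Σ_j exp(2πi⟪ξ,x_j⟫)‖²;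
{dist p q}); hcpPeriodicConfiguration, PeriodicConfiguration, lennardJones, interactionEnergy,
groundStateEnergy, IsCrystallizing,
HasPeriodicGroundStateEnergy, LennardJonesMinimalDistance exist in
Literature.MathematicalPhysics.StatisticalMechanics; Mathlib supplies
FourierTransform.fourier on EuclideanSpace ℝ (Fin 3). Bib: AnningErdos1945 added this session
(doi:10.1090/s0002-9904-1945-08407-9).

Novelty: Searches (2026-08-15, this session): `lit search --source crossref "Anning Erdős integral
distances"` (6: AnningErdos1945 found, added to bib);
`lit search --source zbmath "Fourier quasicrystals discrete spectrum"` (8: LevOlevskii2016/2017,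
Meyer 2017 RMI, Kolountzakis 2016 Fourier pairs
with little structure, Olevskii–Ulanovskii 2020 unit masses, Gouéré 2005, Baake–Moody–Pleasants
2000, Palamodov 2017); `lit search --source
crossref "Fourier quasicrystals spectrum supported on spheres"` (Favorov 2023 bounded-density
spectrum, LevOlevskii2017, Favorov 2017); `lit
search --source crossref "point sets with distances in a lattice distance set periodicity"` (0
relevant); `lit galaxy search --star all`
"integral distances" (Guy's Unsolved Problems D-section, Kurz–Wassermann plane integral point sets,
arXiv:1811.06765 integral point sets over
finite fields — finite/extremal questions, not Delone rigidity), "Fourier quasicrystals" (CKMRV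
interpolation paper, Fisher–Rabson
Fourier-space crystallography, Akiyama–Arnoux LNM 2273), "crystalline measures" (0); `lit frontier
AtomisticToContinuum --since 2022` (30 rows:
Bose gases, kinetic limits, 2-D crystallization for arbitrary norms arXiv:2407.20762 — nothing on
diffraction rigidity); `lit bridges
AtomisticToContinuum --cross any` (nothing joining crystallization roots to Fourier-quasicrystal
roots); searchd hybrid index rc 75 at 18:40Z
(logged); plus gen-1's zbmath sweep (LevOlevskii ×3, Favorov ×2, Meyer2022, BaakeFrettlohGrimm2007 §  [refs: 10.1007/s00222-014-0542-z, 1811.06765, 2407.20762, 1512.08735, doi:10.1007/s00222-014-0542-z, AnningErdos1945, LevOlevskii2016, LevOlevskii2017, Meyer2022, BaakeFrettlohGrimm2007, GrimmBaake2008, AlonEtAl2024, Meyer2016, CohnKumar2006, LevOlevskii2014, CohnEtAl2019]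

Barriers (technique_class: complementary-slackness, lev-olevskii, distance-arithmetic): - technique_class: complementary-slackness, lev-olevskii, distance-arithmetic
- Literature.Barriers.AtomisticToContinuum.KissingTwelveDegeneracy: evaded structurally — no contact
graph, shell or coordination number is read; a Barlow stacking with a positive density of c-letters
carries the fcc-only distance √8·a (8 ∉ D²_hcp/a²) at positive pair density and is excluded by (S2)
once U is strict; zero-density-fault stackings satisfy the existential conclusion anyway
(AperiodicKissingTwelvePackings is consistent with both rigidity cruxes).
- Literature.Barriers.AtomisticToContinuum.ShortRangeStackingBlindness: consistent — the selecting
information sits at √8·a ≈ 2.83a > √(8/3)a (U-strictness) and in f̂'s weights on the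
stacking-sensitive reflections, i.e. beyond the blind range, read globally through (S2)/(S3); the
route needs the certificate to be strict there (design requirement recorded in StrictCertificate).
- Literature.Barriers.AtomisticToContinuum.FlexibleKissingArrangements: not engaged — no
single-shell rigidity is claimed; icosahedral shells (edge 1.0515a) and Boerdijk–Coxeter helices
(25/9·a²) carry non-template distances at positive pair density and fail (S2).
- Literature.Barriers.AtomisticToContinuum.Hubbard1978_mostHomogeneous: Sturmian / most-homogeneous
stackings have pure point spectra on height sets dense in the rods ⇒ excluded by (S3) against
radially discrete Bragg spheres (for t ∉ ℚ non-quadratic the admissible heights are (8h)⁻¹ℤ); the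
barrier bites only i

History (route lifecycle, newest last):
- 2026-08-24T06:33:32Z · DORMANT — reconciler: no traction for 6.6 d (last activity item-evidence-added at 2026-08-17T16:13:18Z); parked, not closed — `ledger route dormant route-AtomisticToConti (operator:999:3727168)

sub-problem: Crystallization · status: dormant · opened planner-plancard-AtomisticToContinuum-Crystal-d6b0e32f-g2-0 2026-08-15T19:00:32Z · rev 0 · ledger route-AtomisticToContinuum-BraggSlacknessRigidity
GENERATED by the gate from the ledger (D-0016/17). Provers cite these decls: `theorem foo : Summit.AtomisticToContinuum.Crystallization.Theses.BraggSlacknessRigidity.<Decl> := …` in Summits/AtomisticToContinuum/Crystallization/Theorems/<Name>.lean.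
-/

namespace Summit.AtomisticToContinuum.Crystallization.Theses.BraggSlacknessRigidity

open scoped BigOperators Topology Manifold Classical MeasureTheory ProbabilityTheory Matrix InnerProductSpace ComplexConjugate ContinuousMap
open Filter Set Function TopologicalSpace MeasureTheory

attribute [summit_statement] _root_.Crystallization

/-- item stmt-AtomisticToContinuum-13166 · crux · rank 2 · open · by planner
why it might fail: Uniform discreteness of the SPECTRUM must come from radial data (refuter-12, AlonEtAl2024): for t = h²/a² quadratic (or algebraic of degree ≤ 4) the Gram-pencil/rod arguments leave dense admissible Bragg heights, and the windowed transfer of S3 to local limits is unproved.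
sources: LevOlevskii2014, LevOlevskii2017, AnningErdos1945, BaakeFrettlohGrimm2007, AlonEtAl2024, KurasovSarnak2020
[crux] hcp-TEMPLATE DIFFRACTION RIGIDITY (card item F3, finite-N form). For every hcp template P =
hcpPeriodicConfiguration a h (a, h ≠ 0; layers of the triangular lattice of spacing a at heights kh,
lattice A₂(a) × 2hℤ), every δ > 0 and every sequence x^N of N-point configurations with pairwise
distances ≥ δ: if (S2) for every range R and tolerance η > 0 the number of ordered pairs i ≠ j with
|x_i − x_j| ≤ R whose distance is η-far from D_P = {|p − q| : p, q ∈ P} is o(N), and (S3) for every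
continuous compactly supported h on frequency space whose support avoids 0 and every sphere {‖ξ‖ =
‖k‖}, k in the dual lattice of P.lattice, (1/N)∫ h(ξ)|Σ_j e^{2πi⟨ξ,x_j⟩}|² dξ → 0, THEN there are a
subsequence N_j, translations τ_j, a periodic configuration Q and Q.lattice-periodic multiplicities
m ≥ 1 on Q with Σ_i f(x_i^{N_j} + τ_j) → Σ_{s ∈ Q} m(s) f(s) for every continuous compactly
supported f (exactly the conclusion of IsCrystallizing; existential Q absorbs homometric partners,
polycrystals with growing grains, density-zero faults and any relaxed c/a). [difficulty: XL] -/
@[route_item "route-AtomisticToContinuum-BraggSlacknessRigidity", crux]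
def HcpDiffractionRigidity : Prop :=
  ∀ (P : Literature.MathematicalPhysics.StatisticalMechanics.PeriodicConfiguration 3), (∃ (a h : ℝ) (ha : a ≠ 0) (hh : h ≠ 0), P = Literature.MathematicalPhysics.StatisticalMechanics.hcpPeriodicConfiguration ha hh) → ∀ δ : ℝ, 0 < δ → ∀ x : (N : ℕ) → (Fin N → EuclideanSpace ℝ (Fin 3)), (∀ (N : ℕ) (i j : Fin N), i ≠ j → δ ≤ dist (x N i) (x N j)) → (∀ R η : ℝ, 0 < η → Filter.Tendsto (fun N : ℕ => (Nat.card {p : Fin N × Fin N // p.1 ≠ p.2 ∧ dist (x N p.1) (x N p.2) ≤ R ∧ ∀ a ∈ P.points, ∀ b ∈ P.points, η ≤ |dist (x N p.1) (x N p.2) - dist a b|} : ℝ) / N) Filter.atTop (nhds 0)) → (∀ h : EuclideanSpace ℝ (Fin 3) → ℝ, Continuous h → HasCompactSupport h → (∀ ξ ∈ tsupport h, ξ ≠ 0 ∧ ∀ k : EuclideanSpace ℝ (Fin 3), (∀ g ∈ P.lattice, ∃ n : ℤ, inner ℝ k g = (n : ℝ)) → ‖ξ‖ ≠ ‖k‖)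 → Filter.Tendsto (fun N : ℕ => (∫ ξ, h ξ * ‖∑ j : Fin N, Complex.exp (2 * Real.pi * Complex.I * (inner ℝ ξ (x N j) : ℂ))‖ ^ 2) / N) Filter.atTop (nhds 0)) → ∃ (φ : ℕ → ℕ) (τ : ℕ → EuclideanSpace ℝ (Fin 3)) (Q : Literature.MathematicalPhysics.StatisticalMechanics.PeriodicConfiguration 3) (m : EuclideanSpace ℝ (Fin 3) → ℕ), StrictMono φ ∧ (∀ s ∈ Q.points, 1 ≤ m s) ∧ (∀ g ∈ Q.lattice, ∀ s, m (s + g) = m s) ∧ ∀ f : EuclideanSpace ℝ (Fin 3) → ℝ, Continuous f → HasCompactSupport f → Filter.Tendsto (fun j => ∑ i : Fin (φ j), f (x (φ j) i + τ j)) Filter.atTop (nhds (∑' s : Q.points, (m s : ℝ) * f s))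

/-- item stmt-AtomisticToContinuum-13167 · crux · rank 3 · open · by planner
why it might fail: Shares every certificate route's open bet (Li2022 gap on the two-point ray; CrystalThreeCone NoGap numerics) and adds strictness: exactness may force U to vanish off D_P or f̂ on a non-Bragg sphere, and f̂ ≥ 0 with f̂(0) = 0 must beat the −r⁻⁶ tail; hcp must be THE periodic minimiser.
sources: CohnKumar2006, CohnEtAl2019, Li2022, Ruelle1969, TorquatoStillinger2008, Suto2006
[crux] STRICT EXACT CERTIFICATE FOR LENNARD-JONES AT AN hcp TEMPLATE (card item F4 + the card's
design requirement). There are P = hcpPeriodicConfiguration a h, ρ, c and g, U, f : ℝ → ℝ with V_LJ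
= g + U + f on (0,∞), U ≥ 0 on (0,∞), g ≡ 0 on [ρ,∞), f of positive type on ℝ³ as a radial function
(finite quadratic forms), g c-stable on all finite configurations of distinct points, c + f(0)/2 =
−e(P) [these clauses are CrystalThreeCone's ExactCertificate with P specialised to hcp], AND: U
continuous on (0,∞) with U(r) = 0 ⇒ r ∈ D_P; F(v) = f(‖v‖) continuous and integrable on ℝ³ with
integrable Fourier transform 𝓕F, 𝓕F real and ≥ 0 everywhere, and 𝓕F(ξ) ≠ 0 whenever ξ ≠ 0 and ‖ξ‖ is
not the norm of a dual-lattice vector of P.lattice (f̂ may vanish on extinct Bragg spheres).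
Expected: relaxed hcp, a ≈ 0.9712, h/a ≈ √(2/3). [difficulty: open-problem] -/
@[route_item "route-AtomisticToContinuum-BraggSlacknessRigidity", crux]
def StrictCertificate : Prop :=
  ∃ (P : Literature.MathematicalPhysics.StatisticalMechanics.PeriodicConfiguration 3) (ρ c : ℝ) (g U f : ℝ → ℝ), (∃ (a h : ℝ) (ha : a ≠ 0) (hh : h ≠ 0), P = Literature.MathematicalPhysics.StatisticalMechanics.hcpPeriodicConfiguration ha hh) ∧ (∀ r : ℝ, 0 < r → Literature.MathematicalPhysics.StatisticalMechanics.lennardJones r = g r + U r + f r) ∧ (∀ r : ℝ, 0 < r → 0 ≤ U r) ∧ (∀ r : ℝ, ρ ≤ r → g r = 0) ∧ (∀ (n : ℕ) (y : Fin n → EuclideanSpace ℝ (Fin 3)) (w : Fin n → ℝ), 0 ≤ ∑ i, ∑ j, w i * w j * f (dist (y i) (y j))) ∧ (∀ (N : ℕ) (x : Fin N → EuclideanSpace ℝ (Fin 3)), Function.Injective x → -(c * (N : ℝ)) ≤ Literature.MathematicalPhysics.StatisticalMechanics.interactionEnergy g x) ∧ c + f 0 / 2 = -(P.energyPerParticle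 Literature.MathematicalPhysics.StatisticalMechanics.lennardJones) ∧ ContinuousOn U (Set.Ioi 0) ∧ (∀ r : ℝ, 0 < r → U r = 0 → ∃ a ∈ P.points, ∃ b ∈ P.points, r = dist a b) ∧ Continuous (fun v : EuclideanSpace ℝ (Fin 3) => (f ‖v‖ : ℂ)) ∧ MeasureTheory.Integrable (fun v : EuclideanSpace ℝ (Fin 3) => (f ‖v‖ : ℂ)) ∧ MeasureTheory.Integrable (FourierTransform.fourier (fun v : EuclideanSpace ℝ (Fin 3) => (f ‖v‖ : ℂ))) ∧ (∀ ξ : EuclideanSpace ℝ (Fin 3), (FourierTransform.fourier (fun v : EuclideanSpace ℝ (Fin 3) => (f ‖v‖ : ℂ)) ξ).im = 0 ∧ 0 ≤ (FourierTransform.fourier (fun v : EuclideanSpace ℝ (Fin 3) => (f ‖v‖ : ℂ)) ξ).re) ∧ (∀ ξ : EuclideanSpace ℝ (Fin 3), ξ ≠ 0 → (∀ k : EuclideanSpace ℝ (Fin 3), (∀ g ∈ P.lattice, ∃ n : ℤ, inner ℝ k g = (n : ℝ)) → ‖ξ‖ ≠ ‖k‖) → FourierTransform.fourier (fun v : EuclideanSpace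 ℝ (Fin 3) => (f ‖v‖ : ℂ)) ξ ≠ 0)

/-- item stmt-AtomisticToContinuum-13168 · crux · rank 4 · closed · proved by Summit.AtomisticToContinuum.Crystallization.Theorems.commensurateHcpRigidity_proof @ 844008ffee8b (prover) · by planner
why it might fail: Sheet-like or sparse local limits (rods, diffuse background) must be excluded by S3 alone; the windowed transfer of S3 (Plancherel + l.s.c.) is unproved in this finite-N form; an hcp twin network of bounded spacing with all cross distances in D_P would stress step (A).
sources: LevOlevskii2014, GrimmBaake2008, BaakeGrimm2013, HalesDSP2012, BlancLewin2015
[crux] THE COMMENSURATE CASE (the card's "ideal test", first theorem): HcpDiffractionRigidity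
restricted to hcp templates with h² = q a², q ∈ ℚ (ideal hcp: q = 2/3), so that D_P² ⊂ (a²/(3·den
q))ℕ. Proof plan: (A) around all but o(N) particles every pair in the R_N-ball is η_N-close to D_P
(η_N → 0, R_N → ∞), so in any local limit Λ∞ ALL squared distances lie in αℕ; Gram/frame integrality
⟨z − p₀, f_i⟩ ∈ (α/2)ℤ puts Λ∞ inside p₀ + (α/2)F* — ONE lattice M; (B) the autocorrelation γ of Λ∞
lives on M, so γ̂ is M*-periodic; M*-periodic + carried by {0} ∪ spheres with radii² in a set
commensurate with M ⇒ supp γ̂ lies in a lattice N ⊇ M* ⇒ γ̂ = Σ_s a_s δ_{s+M*} over finitely many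
classes ⇒ the autocorrelation coefficients are a finite non-negative trigonometric polynomial
attaining its maximum (the density) exactly on a finite-index sublattice L′ ⇒ Λ∞ is L′-periodic off
a density-zero set ⇒ arbitrarily large exact periodic windows ⇒ the conclusion (hard core +
matching, CrystallizationLocalLimit in tree); (C) S3 passes to local limits around most centres by
the Plancherel identity ∫_t |𝓕(ψ_t μ_N)|² = |ψ̂|² ∗ |μ̂_N|², the bound ∫_K |μ̂_N|² ≤ C_δ,K N for
δ-separated points, and lower semi -/
@[route_item "route-AtomisticToContinuum-BraggSlacknessRigidity"]
def CommensurateHcpRigidity : Prop :=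
  ∀ (P : Literature.MathematicalPhysics.StatisticalMechanics.PeriodicConfiguration 3), (∃ (a h : ℝ) (ha : a ≠ 0) (hh : h ≠ 0), P = Literature.MathematicalPhysics.StatisticalMechanics.hcpPeriodicConfiguration ha hh ∧ ∃ q : ℚ, h ^ 2 = (q : ℝ) * a ^ 2) → ∀ δ : ℝ, 0 < δ → ∀ x : (N : ℕ) → (Fin N → EuclideanSpace ℝ (Fin 3)), (∀ (N : ℕ) (i j : Fin N), i ≠ j → δ ≤ dist (x N i) (x N j)) → (∀ R η : ℝ, 0 < η → Filter.Tendsto (fun N : ℕ => (Nat.card {p : Fin N × Fin N // p.1 ≠ p.2 ∧ dist (x N p.1) (x N p.2) ≤ R ∧ ∀ a ∈ P.points, ∀ b ∈ P.points, η ≤ |dist (x N p.1) (x N p.2) - dist a b|} : ℝ) / N) Filter.atTop (nhds 0)) → (∀ h : EuclideanSpace ℝ (Fin 3) → ℝ, Continuous h → HasCompactSupport h → (∀ ξ ∈ tsupport h, ξ ≠ 0 ∧ ∀ k : EuclideanSpace ℝ (Fin 3), (∀ g ∈ P.lattice, ∃ n : ℤ, inner ℝ k g = (n : ℝ)) → ‖ξ‖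 ≠ ‖k‖) → Filter.Tendsto (fun N : ℕ => (∫ ξ, h ξ * ‖∑ j : Fin N, Complex.exp (2 * Real.pi * Complex.I * (inner ℝ ξ (x N j) : ℂ))‖ ^ 2) / N) Filter.atTop (nhds 0)) → ∃ (φ : ℕ → ℕ) (τ : ℕ → EuclideanSpace ℝ (Fin 3)) (Q : Literature.MathematicalPhysics.StatisticalMechanics.PeriodicConfiguration 3) (m : EuclideanSpace ℝ (Fin 3) → ℕ), StrictMono φ ∧ (∀ s ∈ Q.points, 1 ≤ m s) ∧ (∀ g ∈ Q.lattice, ∀ s, m (s + g) = m s) ∧ ∀ f : EuclideanSpace ℝ (Fin 3) → ℝ, Continuous f → HasCompactSupport f → Filter.Tendsto (fun j => ∑ i : Fin (φ j), f (x (φ j) i + τ j)) Filter.atTop (nhds (∑' s : Q.points, (m s : ℝ) * f s))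

/-- item stmt-AtomisticToContinuum-11959 · support · rank 9 · open · by planner
sources: CohnKumar2006, Ruelle1969, Li2022
[crux] EXACT THREE-CONE CERTIFICATE (the thesis' energetic object; card items C2 + C3 merged into
one existence statement, signature identical to gen-1 item 3100): P periodic, ρ < ∞, c, g, U, f with
V_LJ = g + U + f on (0,∞), U ≥ 0, g ≡ 0 on [ρ,∞), f of positive type, g c-stable, and c + f(0)/2 =
−e(P). Finite ρ is the content: with ρ = ∞ (g = V_LJ, U = f = 0) it collapses to KeplerBound; at
finite ρ it says the tail beyond ρ is paid EXACTLY by Bochner + slack (Cohn–Kumar-type one-sided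
interpolation: f ≤ V on [ρ,∞) with equality on D_P ∩ [ρ,∞), per-particle P-sum of f including f(0)
equal to 0, i.e. f̂·|S_P|² = 0 on the reciprocal lattice minus 0 and ∫f = 0 at zero pressure), while
P is simultaneously a per-particle ground state of the finite-range g among ALL finite
configurations, certified by a one-centre inequality, and U vanishes on D_P. [deps:
OnePercentCertificate] [difficulty: open-problem] -/
@[route_item "route-AtomisticToContinuum-BraggSlacknessRigidity"]
def ExactCertificate : Prop :=
  ∃ (P : Literature.MathematicalPhysics.StatisticalMechanics.PeriodicConfiguration 3) (ρ c : ℝ) (g U f : ℝ → ℝ), (∀ r : ℝ, 0 < r → Literature.MathematicalPhysics.StatisticalMechanics.lennardJones r = g r + U r + f r) ∧ (∀ r : ℝ, 0 < r → 0 ≤ U r) ∧ (∀ r : ℝ, ρ ≤ r → g r = 0) ∧ (∀ (n : ℕ) (y : Fin n → EuclideanSpace ℝ (Fin 3)) (w : Fin n → ℝ), 0 ≤ ∑ i, ∑ j, w i * w j * f (dist (y i) (y j))) ∧ (∀ (N : ℕ) (x : Fin N → EuclideanSpace ℝ (Fin 3)), Function.Injective x → -(c * (N : ℝ)) ≤ Literature.MathematicalPhysics.StatisticalMechanics.interactionEnergy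 g x) ∧ c + f 0 / 2 = -(P.energyPerParticle Literature.MathematicalPhysics.StatisticalMechanics.lennardJones)

/-- item stmt-AtomisticToContinuum-11961 · support · rank 9 · open · by planner
sources: BlancLewin2015, Ruelle1969
[support] KEPLER BOUND FOR LENNARD-JONES (finite-N energetic statement, the certificate's output
stripped of g, U, f; gen-1 item 3102): some periodic P has N·e(P) ≤ E_N(x) for every N and every
configuration x of N distinct points — equivalently B_LJ = −e(P): the optimal stability constant is
a periodic energy per particle (expected 8.611 ε = 0.7176 tree units). A by-product other routes may
want; here it follows from ExactCertificate in ten lines (CertificateBound), and it stays claimable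
directly. [difficulty: open-problem] -/
@[route_item "route-AtomisticToContinuum-BraggSlacknessRigidity"]
def KeplerBound : Prop :=
  ∃ P : Literature.MathematicalPhysics.StatisticalMechanics.PeriodicConfiguration 3, ∀ (N : ℕ) (x : Fin N → EuclideanSpace ℝ (Fin 3)), Function.Injective x → (N : ℝ) * P.energyPerParticle Literature.MathematicalPhysics.StatisticalMechanics.lennardJones ≤ Literature.MathematicalPhysics.StatisticalMechanics.interactionEnergy Literature.MathematicalPhysics.StatisticalMechanics.lennardJones x

/-- item stmt-AtomisticToContinuum-11962 · support · rank 9 · closed · proved by Summit.AtomisticToContinuum.Crystallization.Theorems.certificateBound_proof (prover) · by planner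
sources: Ruelle1969
[support] glue, provable now (gen-1 item 3103): an exact certificate gives the Kepler bound — for
injective x all pair distances are > 0 so V = g + U + f termwise; the U-cone is ≥ 0 termwise; the
Bochner form with w ≡ 1, y = x gives N f(0) + 2Σ_{i<j} f ≥ 0 (diagonal terms = f(0);
two_mul_interactionEnergy_eq_sum_sum in tree); g-stability gives Σ_{i<j} g ≥ −cN; add and use c +
f(0)/2 = −e(P). [difficulty: provable-now] -/
@[route_item "route-AtomisticToContinuum-BraggSlacknessRigidity", crux]
def CertificateBound : Prop :=
  ExactCertificate → KeplerBound

/-- item stmt-AtomisticToContinuum-11963 · support · rank 9 · closed · proved by Summit.AtomisticToContinuum.Crystallization.Theorems.trialStateUpper_proof @ 35f8efd1ceb4 (prover) · by planner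
sources: BlancLewin2015
[support] TRIAL-STATE UPPER BOUND per periodic configuration (gen-1 item 3104, refuter-reviewed
TRUE/M): for every periodic Q and ε > 0, eventually E(N)/N ≤ e(Q) + ε (finite blocks of Q as N-point
trial states: boundary O(N^{2/3}) particles lose O(1) each since site energies are bounded by the
summable r⁻⁶ tail, hasSum_lennardJones_dist_three in tree; groundStateEnergy_lennardJones_le needs
no BddBelow). Gives limsup E(N)/N ≤ ⨅_Q e(Q). [difficulty: M] -/
@[route_item "route-AtomisticToContinuum-BraggSlacknessRigidity", crux]
def TrialStateUpper : Prop :=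
  ∀ (Q : Literature.MathematicalPhysics.StatisticalMechanics.PeriodicConfiguration 3) (ε : ℝ), 0 < ε → ∀ᶠ N : ℕ in Filter.atTop, Literature.MathematicalPhysics.StatisticalMechanics.groundStateEnergy Literature.MathematicalPhysics.StatisticalMechanics.lennardJones 3 N / N ≤ Q.energyPerParticle Literature.MathematicalPhysics.StatisticalMechanics.lennardJones + ε

/-- `TrialStateUpper` holds: proved by `Summit.AtomisticToContinuum.Crystallization.Theorems.trialStateUpper_proof` @ 35f8efd1ceb4. -/
theorem TrialStateUpper_holds : TrialStateUpper := _root_.Summit.AtomisticToContinuum.Crystallization.Theorems.trialStateUpper_proof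

/-- item stmt-AtomisticToContinuum-11964 · support · rank 9 · closed · proved by Summit.AtomisticToContinuum.Crystallization.Theorems.energeticHalf_proof @ 65c30484d612 (prover) · by planner
sources: BlancLewin2015
[support] glue, provable now (gen-1 item 3105): KeplerBound + TrialStateUpper ⇒ conjunct (i) — from
N e(P) ≤ E_N(x) get e(P) ≤ E(N)/N for N ≥ 1 (le_ciInf over the non-empty injective configurations,
nonempty_injective_config in tree); with TrialStateUpper at Q = P, E(N)/N → e(P); at general Q, e(P)
≤ e(Q) + ε for all ε, so e(P) IsLeast. [difficulty: provable-now] -/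
@[route_item "route-AtomisticToContinuum-BraggSlacknessRigidity", crux]
def EnergeticHalf : Prop :=
  KeplerBound → TrialStateUpper → Literature.MathematicalPhysics.StatisticalMechanics.HasPeriodicGroundStateEnergy Literature.MathematicalPhysics.StatisticalMechanics.lennardJones 3

/-- `EnergeticHalf` holds: proved by `Summit.AtomisticToContinuum.Crystallization.Theorems.energeticHalf_proof` @ 65c30484d612. -/
theorem EnergeticHalf_holds : EnergeticHalf := _root_.Summit.AtomisticToContinuum.Crystallization.Theorems.energeticHalf_proof

/-- item stmt-AtomisticToContinuum-13169 · support · rank 9 · closed · proved by Summit.AtomisticToContinuum.Crystallization.Theorems.strictImpliesExact_proof @ df74b65ad2fb (prover) · by planner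
sources: Ruelle1969
[support] glue (projection; sorry-free in Sketch.lean): a strict hcp certificate is in particular an
exact one — forget the template description and the last six conjuncts. [difficulty: provable-now] -/
@[route_item "route-AtomisticToContinuum-BraggSlacknessRigidity", crux]
def StrictImpliesExact : Prop :=
  StrictCertificate → ExactCertificate

/-- item stmt-AtomisticToContinuum-13170 · support · rank 9 · closed · proved by Summit.AtomisticToContinuum.Crystallization.Theorems.slacknessTransfer_proof @ 044ba48c176a (prover) · by planner
sources: CohnKumar2006, TorquatoStillinger2008, Suto2006, BlancLewin2015
[support] TWO-SIDED COMPLEMENTARY SLACKNESS (card items F1/F2/F5, finite-N): StrictCertificate →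
TrialStateUpper → LennardJonesMinimalDistance → HcpDiffractionRigidity → IsCrystallizing
lennardJones 3. Proof: for ground states x^N, E(N) − N e(P) = [E_g + cN] + [Σ_{i<j} U(r_ij)] +
½[Σ_{i,j} F(x_i − x_j)], three non-negative brackets, and TrialStateUpper at Q = P makes the left
side ≤ εN eventually, so each bracket is o(N); hard core δ from LennardJonesMinimalDistance (δ = 1/3
in tree); U continuous and > 0 on the compact set {r ∈ [δ,R] : dist(r, D_P) ≥ η} gives (S2); Fourier
inversion for continuous integrable F with integrable 𝓕F (Mathlib Continuous.fourier_inversion /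
Integrable.fourierInv_fourier_eq) gives Σ_{i,j} F(x_i − x_j) = ∫ 𝓕F |Σ_j e^{2πi⟨ξ,x_j⟩}|², and 𝓕F ≥
0, continuous, > 0 on tsupport h bounds the S3 functional by the third bracket;
HcpDiffractionRigidity applied to the certificate's template returns exactly the conclusion of
IsCrystallizing. [difficulty: M] -/
@[route_item "route-AtomisticToContinuum-BraggSlacknessRigidity", crux]
def SlacknessTransfer : Prop :=
  StrictCertificate → TrialStateUpper → Literature.MathematicalPhysics.StatisticalMechanics.LennardJonesMinimalDistance → HcpDiffractionRigidity → Literature.MathematicalPhysics.StatisticalMechanics.IsCrystallizing Literature.MathematicalPhysics.StatisticalMechanics.lennardJones 3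

/-- item stmt-AtomisticToContinuum-13171 · support · rank 9 · closed · proved by Summit.AtomisticToContinuum.Crystallization.Theorems.commensurateOfHcp_proof @ c26f1f606469 (prover) · by planner
sources: LevOlevskii2014
[support] glue (sorry-free in Sketch.lean): the commensurate case is a special case of
HcpDiffractionRigidity; keeps the rank-4 crux honest as a strict weakening and makes its refutation
fatal for the line. [difficulty: provable-now] -/
@[route_item "route-AtomisticToContinuum-BraggSlacknessRigidity"]
def CommensurateOfHcp : Prop :=
  HcpDiffractionRigidity → CommensurateHcpRigidity

/-- item stmt-AtomisticToContinuum-13172 · assembly · rank 1 · closed · proved by Summit.AtomisticToContinuum.Crystallization.Theorems.braggSlacknessRigidity_assembly_proof @ 4d7f5c168806 (prover) · by planner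
sources: BlancLewin2015, CohnKumar2006, LevOlevskii2014
[assembly] StrictCertificate → HcpDiffractionRigidity → StrictImpliesExact → CertificateBound →
EnergeticHalf → TrialStateUpper → SlacknessTransfer → Crystallization (the sub-problem decl
`_root_.Crystallization`). -/
@[route_item "route-AtomisticToContinuum-BraggSlacknessRigidity"]
def Assembly : Prop :=
  StrictCertificate → HcpDiffractionRigidity → StrictImpliesExact → CertificateBound → EnergeticHalf → TrialStateUpper → SlacknessTransfer → Crystallization

/-! D-0027 §2.1 — DECIDING THEOREM (planner-authored via `route open/edit --closes-file`; by planner-plancard-AtomisticToContinuum-Crystal-d6b0e32f-g2-0 2026-08-15T19:00:32Z):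
its hypotheses are this route's items and its conclusion the sub-problem Statement (glue_lint), and it elaborates with this file. -/

@[closes "route-AtomisticToContinuum-BraggSlacknessRigidity"] theorem closes (h₁ : StrictCertificate) (h₂ : HcpDiffractionRigidity) (h₃ : StrictImpliesExact)
    (h₄ : CertificateBound) (h₅ : EnergeticHalf) (h₆ : TrialStateUpper) (h₇ : SlacknessTransfer) :
    _root_.Crystallization :=
  ⟨h₅ (h₄ (h₃ h₁)) h₆,
    h₇ h₁ h₆ Literature.MathematicalPhysics.StatisticalMechanics.LennardJonesMinimalDistance_holds h₂⟩

end Summit.AtomisticToContinuum.Crystallization.Theses.BraggSlacknessRigidity
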